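import Summits.BirchSwinnertonDyer.Rank1Residual.Supersingular.X7VisibilityRecordsC1
import Summits.BirchSwinnertonDyer.Rank1Residual.Supersingular.RankOneRem13NoCertificate
import Summits.BirchSwinnertonDyer.Rank1Residual.Supersingular.IntModelMinimalityKrausTwoMore
import Literature.NumberTheory.EllipticCurves.Fisher2012.HesseFamilyFiveIndClosedForms
import Literature.NumberTheory.EllipticCurves.Rank1Residual.Typed.X7
import Summits.BirchSwinnertonDyer.Rank1Residual.Supersingular.RankZeroSurjCertificatesX7_20
import HarnessLib

/-!
# N5 (X7 ∧ r_an = 0, p ≥ 5) by VISIBILITY — per-pair `BSD(E,p)` for cells WITHOUT any per-pair theorem of record, from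
# `p`-congruent RANK-2 partners, Wuthrich's upper bound, Cassels–Tate and the refined count (file C6: `422370du1 @ 7`)

Cell `b2b-bsdres`, supersingular family, prover A = unit `b2b-bsdres-x10b` (gen 16), X7 joint pair A side.  Topic file;
namespace `Summit.BirchSwinnertonDyer.Rank1Residual.Supersingular`.  THEOREMS ONLY; no named fact, no definition,
nothing booked; X7 stays CONSTRUCTION-SHAPED (mark of RESIDUAL-MAP §I N5 unchanged).  Method, shapes and census as in
`X7VisibilityRecordsC1.lean` (X7 shape `X7RankZero.bsdp_of_casselsTate_of_congr_of_places_of_surj`, x10b gen 15) and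
`X6VisibilityTamDefectShape.lean`; this is the seventh of the 7 N5 cells for which the DB-partner census (kit j156242) certified a
Cremona rank-2 partner and no per-pair theorem existed — left over in gen 15 because `|Δ_E| > 512¹²` needs the FACTORED form of Kraus'
criterion (additive-p3's `isGloballyMinimal_of_krausCriterion₃_factored`).  New w.r.t. C1–C5: a place of kind (iii) (`13`: both curves
NON-split multiplicative, `#E(ℚ₁₃)[7] = #F(ℚ₁₃)[7] = 7`), so the partner's Cremona model is shown minimal too (kernel, bounded Kraus) and the
multiplicative reductions at `13` are read off the integer models in the kernel.

HONEST FRAMING (run/shared/lean/b2b/bsd-rank1-residual/, verbatim in every file): the goal of the cell is to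
DELETE the COMBINATION-SHAPED residual classes of the Birch–Swinnerton-Dyer formula for ALL analytic-rank `≤ 1`
elliptic curves over `ℚ` — "full BSD formula for every rank `≤ 1` curve in class `C`" assembled STRICTLY from
published theorems — so that the rank-`≤ 1` remainder becomes exactly the CONSTRUCTION-SHAPED classes, which are
TYPED (missing-input `Prop`s), NOT attempted.  This is not "finishing BSD".

References: Cremona–Mazur 2000 §3 [CremonaMazur2000]; Wuthrich 2014 Prop. 21 [Wuthrich2014]; Silverman AEC VII.5.1, X.4.14
[SilvermanAEC2009]; ATAEC V [SilvermanATAEC1994]; Kraus 1989 [Kraus1989]; Cremona's tables [Cremona2006];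
HOME/b2b-bsdres-x10b/X7-KURIHARA.md (gen 16 section).
-/

set_option autoImplicit false

noncomputable section

open scoped Classical

open WeierstrassCurve Literature.NumberTheory.EllipticCurves
  Literature.NumberTheory.EllipticCurves.Rank1Residual
  Literature.NumberTheory.EllipticCurves.Rank1Residual.Typed
  Literature.NumberTheory.EllipticCurves.Rank1Residual.X11RankOneCertificates
  Literature.NumberTheory.EllipticCurves.Wuthrich2014
  Literature.NumberTheory.EllipticCurves.Fisher2016
  Literature.NumberTheory.EllipticCurves.Fisher2012
  Summit.BirchSwinnertonDyer.BirchSwinnertonDyer.Rank1Residual.IntModel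
  Summit.BirchSwinnertonDyer.Rank1Residual.X11b
open NumberField IsDedekindDomain Rat.HeightOneSpectrum

namespace Summit.BirchSwinnertonDyer.Rank1Residual.Supersingular

/-! ### `422370du1 @ 7` ← `422370dy1` (Cremona, rank 2, the SAME conductor `422370 = 2·3·5·13·19²`; X7 ∧ `r_an = 0`, `#Ш_an = 7²`, `∏c` prime to `7`) -/

/-- `422370du1` (Cremona's minimal model) is an elliptic curve. [cite: Cremona2006, Table 1 (Cremona label 422370du1)] -/
theorem isElliptic_c422370du1 : (⟨1, -1, 1, -1782219521048, -925402892231841253⟩ : WeierstrassCurve ℚ).IsElliptic :=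
  isElliptic_of_discOf_ne_zero 1 (-1) 1 (-1782219521048) (-925402892231841253) (by decide +kernel)

/-- `422370du1` is globally minimal: complete factorisation `|Δ| = 2^10·3^36·5^4·13^1·19^10` kernel-checked and Kraus' criterion prime by prime
(additive-p3's `isGloballyMinimal_of_krausCriterion₃_factored`, `|Δ| ≥ 512¹²`). [cite: SilvermanAEC2009, VII.1 Remark 1.1] [cite: Kraus1989, Prop. 1 and Prop. 2] -/
theorem isGloballyMinimal_c422370du1 : (⟨1, -1, 1, -1782219521048, -925402892231841253⟩ : WeierstrassCurve ℚ).IsGloballyMinimal :=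
  isGloballyMinimal_of_krausCriterion₃_factored 1 (-1) 1 (-1782219521048) (-925402892231841253)
    [(2, 10), (3, 36), (5, 4), (13, 1), (19, 10)] (by decide +kernel)
    (by intro qe hqe; simp only [List.mem_cons, List.not_mem_nil, or_false] at hqe
        rcases hqe with rfl | rfl | rfl | rfl | rfl <;> norm_num)
    (by set_option synthInstance.maxSize 2000 in decide +kernel)

/-- `422370dy1` (Cremona's minimal model) is an elliptic curve. [cite: Cremona2006, Table 1 (Cremona label 422370dy1)] -/
theorem isElliptic_c422370dy1 : (⟨1, -1, 1, -68, 2207⟩ : WeierstrassCurve ℚ).IsElliptic :=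
  isElliptic_of_discOf_ne_zero 1 (-1) 1 (-68) 2207 (by decide +kernel)

/-- `422370dy1` is globally minimal (Kraus' bounded criterion, kernel). [cite: SilvermanAEC2009, VII.1 Remark 1.1] -/
theorem isGloballyMinimal_c422370dy1 : (⟨1, -1, 1, -68, 2207⟩ : WeierstrassCurve ℚ).IsGloballyMinimal :=
  isGloballyMinimal_of_krausCriterion_bounded₂ 1 (-1) 1 (-68) 2207 (by decide +kernel) (by decide +kernel) (by decide +kernel)

/-- `#Ẽ(𝔽_7) = 8` for `422370du1` (`a_7 = 0`: good SUPERSINGULAR at `7`; kernel count). [folklore] -/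
theorem card_c422370du1_7 :
    Nat.card (((⟨1, -1, 1, -1782219521048, -925402892231841253⟩ : WeierstrassCurve ℤ).map (Int.castRingHom (ZMod 7))).toAffine.Point) = 8 :=
  haveI : Fact (Nat.Prime 7) := ⟨by norm_num⟩
  natCard_point_eq_of_countPoints 1 (-1) 1 (-1782219521048) (-925402892231841253) 7 (by norm_num) (by decide +kernel) (by decide +kernel)

/-- **`BSD(E,7)` for `422370du1`** (N5 cell WITHOUT a per-pair theorem so far: class X7, good supersingular at `7` (`#Ẽ(𝔽₇) = 8`),
additive at `3` and `19`, `r_an = 0`, `#Ш_an = 7²`) from PUBLISHED theorems — Cassels–Tate (`hCT`), Wuthrich 2014 Prop. 21 (`hW`), GZK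
(`hGZK`), modularity (`hmod`), Tate uniformisation (`hU`, `hU2`) — and a VISIBLE element of `Ш(E)[7]` explained by the `7`-CONGRUENT
RANK-2 curve `F = 422370dy1` of the same conductor (Cremona; points `(3, 43)`, `(-9, 49)` independent in `F(ℚ)/7F(ℚ)` by reduction
functionals at `137, 139`; DB-partner census kit j156242, `a_ℓ(E) ≡ a_ℓ(F) (mod 7)` at every good `ℓ ≤ 3000`).  Places (E/F): `2`
split/split with `#F(ℚ₂)[7] = 1` (kind (i)); `3` additive/additive (i); `5` nonsplit/nonsplit (i); `7` good/good (PAID: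
`7·#F(ℚ₇)[7] = 7 < 49 ≤ 7^{rank F}`); `13` nonsplit/nonsplit with `#E(ℚ₁₃)[7] = #F(ℚ₁₃)[7] = 7`: kind (iii) — both multiplicative
(KERNEL: `13 ∣ Δ`, `13 ∤ c₄` on both integer models), `γ(E)/γ(F) ∈ ℚ₁₃^{×2}` and `μ₇(ℚ₁₃) = 1` (`13 ≢ 1 (mod 7)`) displayed (`h13`);
`19` additive/additive (i).  KERNEL: minimality of both Cremona models (E by the FACTORED Kraus criterion,
`|Δ_E| = 2^10·3^36·5^4·13·19^10 > 512¹²`; F bounded), `ClassX7 E 7` (`classX7_of_intModel`, additive prime `3`), `surj(7)` (B's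
`surj_x7r0_422370du1_7`), good reduction of both curves off `S = {2,3,5,7,13,19}` (discriminant supports), `7 ∤ #E(ℚ)`.
Displayed binders: `θ` (`hθ`), `rank F ≥ 2` (`hrank`), the local data `h2 h3 h5 h7 h13 h19` (two engines in gen 15's census:
PARI `factorpadic` of `ψ_7` + the structure rules), `r_an = 0`, `ord_7 #Ш_an ≤ 2`.  Per pair (an OFFER for referee A); NOT a class
theorem; nothing booked. [cite: Wuthrich2014, Prop. 21 (p. 400)] [cite: CremonaMazur2000, §3 and Table 1]
[cite: SilvermanATAEC1994, Ch. V Thm. 3.1, Lemma 5.2, Thm. 5.3, Cor. 5.4] [cite: SilvermanAEC2009, VII.5 Prop. 5.1 and Thm. X.4.14]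
[cite: Cremona2006, Table 1 (Cremona labels 422370du1, 422370dy1)] -/
theorem bsdp_x7r0vis_422370du1_7_of_congr
    (hCT : exists_casselsTate_pairing (K := ℚ)) (hW : sha_dvd_analyticSha)
    (hGZK : rank_eq_analyticRank_of_analyticRank_le_one) (hmod : hasEntireLFunction_rat)
    (hU : Silverman1994_thmV53_tateUniformisation.{0})
    (hU2 : Silverman1994_thmV53_corV54_tateUniformisation.{0})
    {W F : WeierstrassCurve ℚ} [W.IsElliptic] [W.IsGloballyMinimal] [F.IsElliptic] [F.IsGloballyMinimal]
    (hWeq : W = ⟨1, -1, 1, -1782219521048, -925402892231841253⟩) (hFeq : F = ⟨1, -1, 1, -68, 2207⟩)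
    (hr0 : W.analyticRank = 0) {q : ℚ} (hq : shaAn W = (q : ℂ)) (hv : padicValRat 7 q ≤ 2)
    (θ : geomTorsion F (7 : ℤ) ≃+ geomTorsion W (7 : ℤ))
    (hθ : ∀ (σ : Field.absoluteGaloisGroup ℚ) (P : geomTorsion F (7 : ℤ)), θ (σ • P) = σ • θ P)
    (hrank : 2 ≤ F.mordellWeilRank)
    (h2 : ∀ w : HeightOneSpectrum (𝓞 ℚ), (primesEquiv w : ℕ) = 2 →
      Nat.card (nsmulAddMonoidHom 7 : (F.baseChange (w.adicCompletion ℚ)).toAffine.Point →+ _).ker = 1)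
    (h3 : ∀ w : HeightOneSpectrum (𝓞 ℚ), (primesEquiv w : ℕ) = 3 →
      Nat.card (nsmulAddMonoidHom 7 : (F.baseChange (w.adicCompletion ℚ)).toAffine.Point →+ _).ker = 1)
    (h5 : ∀ w : HeightOneSpectrum (𝓞 ℚ), (primesEquiv w : ℕ) = 5 →
      Nat.card (nsmulAddMonoidHom 7 : (F.baseChange (w.adicCompletion ℚ)).toAffine.Point →+ _).ker = 1)
    (h7 : ∀ w : HeightOneSpectrum (𝓞 ℚ), (primesEquiv w : ℕ) = 7 →
      Nat.card (nsmulAddMonoidHom 7 : (F.baseChange (w.adicCompletion ℚ)).toAffine.Point →+ _).ker = 1)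
    (h13 : ∀ w : HeightOneSpectrum (𝓞 ℚ), (primesEquiv w : ℕ) = 13 →
      (∃ r : w.adicCompletion ℚ, algebraMap ℚ (w.adicCompletion ℚ) (-(W.c₄ / W.c₆)) =
          r ^ 2 * algebraMap ℚ (w.adicCompletion ℚ) (-(F.c₄ / F.c₆))) ∧
        (∀ ζ : w.adicCompletion ℚ, ζ ^ 7 = 1 → ζ = 1))
    (h19 : ∀ w : HeightOneSpectrum (𝓞 ℚ), (primesEquiv w : ℕ) = 19 →
      Nat.card (nsmulAddMonoidHom 7 : (F.baseChange (w.adicCompletion ℚ)).toAffine.Point →+ _).ker = 1)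
    : BSDp W 7 := by
  haveI : Fact (Nat.Prime 7) := ⟨by norm_num⟩
  have hIW : integralModelInt W = ⟨1, -1, 1, -1782219521048, -925402892231841253⟩ :=
    integralModelInt_eq_of_map_eq _ (by rw [hWeq]; ext <;> simp [WeierstrassCurve.map])
  have hIF : integralModelInt F = ⟨1, -1, 1, -68, 2207⟩ :=
    integralModelInt_eq_of_map_eq _ (by rw [hFeq]; ext <;> simp [WeierstrassCurve.map])
  have hX : ClassX7 W 7 :=
    classX7_of_intModel 7 hIW (by decide +kernel) card_c422370du1_7 (by decide) 3 (by norm_num) (by decide +kernel)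
      (by decide +kernel)
  have hs : Surj W 7 := (by rw [hWeq]; exact surj_x7r0_422370du1_7)
  set L : List ℕ := [2, 3, 5, 7, 13, 19] with hL
  have hLp : ∀ q ∈ L, q.Prime := by decide
  have hΔE : ∀ q : ℕ, q.Prime → (q : ℤ) ∣ (⟨1, -1, 1, -1782219521048, -925402892231841253⟩ : WeierstrassCurve ℤ).Δ → q ∈ L :=
    forall_mem_of_natAbs_eq_prod_pow L [10, 36, 4, 0, 1, 10] hLp (by decide +kernel)
  have hΔF : ∀ q : ℕ, q.Prime → (q : ℤ) ∣ (⟨1, -1, 1, -68, 2207⟩ : WeierstrassCurve ℤ).Δ → q ∈ L :=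
    forall_mem_of_natAbs_eq_prod_pow L [3, 7, 2, 0, 1, 2] hLp (by decide +kernel)
  set e := primesEquiv (R := 𝓞 ℚ) with he
  set v₀ : HeightOneSpectrum (𝓞 ℚ) := e.symm ⟨7, Fact.out⟩ with hv₀def
  have hv₀ : (e v₀ : ℕ) = 7 := by rw [hv₀def, Equiv.apply_symm_apply]
  have heqp : ∀ w : HeightOneSpectrum (𝓞 ℚ), (e w : ℕ) = 7 → w = v₀ := by
    intro w hw
    have h1 : e w = ⟨7, Fact.out⟩ := Subtype.ext hw
    rw [hv₀def, ← h1, Equiv.symm_apply_apply]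
  set S : Finset (HeightOneSpectrum (𝓞 ℚ)) :=
    (L.filterMap fun r ↦ if h : r.Prime then some (e.symm ⟨r, h⟩) else none).toFinset with hSdef
  have hmemS : ∀ w : HeightOneSpectrum (𝓞 ℚ), w ∈ S ↔ (e w : ℕ) ∈ L := by
    intro w
    rw [hSdef, List.mem_toFinset, List.mem_filterMap]
    constructor
    · rintro ⟨r, hr, hrw⟩
      by_cases hrp : r.Prime
      · rw [dif_pos hrp, Option.some.injEq] at hrw
        rw [← hrw, Equiv.apply_symm_apply]
        exact hr
      · rw [dif_neg hrp] at hrw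
        exact absurd hrw (by simp)
    · intro hw
      refine ⟨(e w : ℕ), hw, ?_⟩
      rw [dif_pos (e w).2]
      simp
  set T : Finset (HeightOneSpectrum (𝓞 ℚ)) := {v₀} with hTdef
  have hTS : T ⊆ S := by
    intro w hw
    rw [hTdef, Finset.mem_singleton] at hw
    rw [hmemS, hw, hv₀]; decide
  have hS : ∀ w : HeightOneSpectrum (𝓞 ℚ), w ∉ S →
      W.HasGoodReductionAt w ∧ F.HasGoodReductionAt w ∧ ((7 : ℕ) : 𝓞 ℚ) ∉ w.asIdeal := by
    intro w hwS
    have hwL : (e w : ℕ) ∉ L := fun h ↦ hwS ((hmemS w).mpr h)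
    have hq : (e w : ℕ).Prime := (e w).2
    refine ⟨?_, ?_, natCast_not_mem_of_primesEquiv_ne w Fact.out fun h ↦ hwL ?_⟩
    · rw [hWeq]; exact hasGoodReductionAt_mk_of_primesEquiv _ _ _ _ _ w rfl fun h ↦ hwL (hΔE _ hq h)
    · rw [hFeq]; exact hasGoodReductionAt_mk_of_primesEquiv _ _ _ _ _ w rfl fun h ↦ hwL (hΔF _ hq h)
    · show (primesEquiv w : ℕ) ∈ L
      rw [h]; decide
  have hcardp : ∏ w ∈ T, Nat.card (w.adicCompletionIntegers ℚ ⧸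
      Ideal.span {((7 : ℕ) : w.adicCompletionIntegers ℚ)}) = 7 ^ Module.finrank ℚ ℚ :=
    WeierstrassCurve.prod_natCard_quot_adicCompletionIntegers (K := ℚ) (p := 7) T fun w hw h ↦
      hw (by rw [hTdef, Finset.mem_singleton]; exact heqp w (primesEquiv_eq_of_natCast_mem Fact.out h))
  have hT : (∏ w ∈ T, Nat.card (nsmulAddMonoidHom 7 :
        (F.baseChange (w.adicCompletion ℚ)).toAffine.Point →+ _).ker *
        Nat.card (w.adicCompletionIntegers ℚ ⧸
          Ideal.span {((7 : ℕ) : w.adicCompletionIntegers ℚ)})) < 7 ^ F.mordellWeilRank := by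
    rw [Finset.prod_mul_distrib, hcardp, Module.finrank_self, hTdef, Finset.prod_singleton, h7 v₀ hv₀]
    calc (1 : ℕ) * 7 ^ 1 < 7 ^ 2 := by norm_num
      _ ≤ 7 ^ F.mordellWeilRank := Nat.pow_le_pow_right (by norm_num) hrank
  have hplaces : ∀ w ∈ S, w ∉ T →
      (((7 : ℕ) : 𝓞 ℚ) ∉ w.asIdeal ∧ Nat.card (nsmulAddMonoidHom 7 :
          (F.baseChange (w.adicCompletion ℚ)).toAffine.Point →+ _).ker = 1) ∨
      (W.HasSplitMultiplicativeReductionAt w ∧ F.HasSplitMultiplicativeReductionAt w ∧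
        Nat.card (nsmulAddMonoidHom 7 :
          (W.baseChange (w.adicCompletion ℚ)).toAffine.Point →+ _).ker ≤ 7) ∨
      (W.HasMultiplicativeReductionAt w ∧ F.HasMultiplicativeReductionAt w ∧
        (∃ r : w.adicCompletion ℚ, algebraMap ℚ (w.adicCompletion ℚ) (-(W.c₄ / W.c₆)) =
          r ^ 2 * algebraMap ℚ (w.adicCompletion ℚ) (-(F.c₄ / F.c₆))) ∧
        (∀ ζ : w.adicCompletion ℚ, ζ ^ 7 = 1 → ζ = 1)) := by
    intro w hwS hwT
    have hwL : (e w : ℕ) ∈ L := (hmemS w).mp hwS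
    have hwp : (e w : ℕ) ≠ 7 := fun h ↦ hwT (by rw [hTdef, Finset.mem_singleton]; exact heqp w h)
    have hcases : (e w : ℕ) = 2 ∨ (e w : ℕ) = 3 ∨ (e w : ℕ) = 5 ∨ (e w : ℕ) = 13 ∨ (e w : ℕ) = 19 := by
      simp only [hL, List.mem_cons, List.mem_nil_iff, or_false] at hwL
      omega
    rcases hcases with hw | hw | hw | hw | hw
    · -- 2: kind (i)
      exact Or.inl ⟨natCast_not_mem_of_primesEquiv_ne w Fact.out hwp, h2 w hw⟩
    · -- 3: kind (i)
      exact Or.inl ⟨natCast_not_mem_of_primesEquiv_ne w Fact.out hwp, h3 w hw⟩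
    · -- 5: kind (i)
      exact Or.inl ⟨natCast_not_mem_of_primesEquiv_ne w Fact.out hwp, h5 w hw⟩
    · -- 13: kind (iii): both multiplicative (kernel), same γ-class and μ_7(ℚ_13) = 1 (binders)
      exact Or.inr (Or.inr (⟨hasMultiplicativeReductionAt_of_intModel_of_primesEquiv hIW w hw
        (by decide +kernel) (by decide +kernel), hasMultiplicativeReductionAt_of_intModel_of_primesEquiv hIF w hw
        (by decide +kernel) (by decide +kernel), h13 w hw⟩))
    · -- 19: kind (i)
      exact Or.inl ⟨natCast_not_mem_of_primesEquiv_ne w Fact.out hwp, h19 w hw⟩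
  exact X7RankZero.bsdp_of_casselsTate_of_congr_of_places_of_surj hCT hW hGZK hmod hU hU2 W 7 (by norm_num) hX hs hr0
    hq hv F θ hθ S T hTS hS hT hplaces

end Summit.BirchSwinnertonDyer.Rank1Residual.Supersingular

end
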